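import Literature.AlgebraicGeometry.ComplexMultiplication.EndomorphismFieldWeilTypePairsExist
import Literature.AlgebraicGeometry.Pohlmann1968.SimpleDegenerateCMAbelianVarietiesCompositeDimensionExist
import HarnessLib

/-!
# Simple CM pairs of Weil type and corank one exist in EVERY even dimension `2k ≥ 4`: `Bᵏ(A) ≠ Dᵏ(A)` on a SIMPLE
# CM abelian `2k`-fold, `Bᵏ ⊗ ℂ = Dᵏ ⊗ ℂ ⊕ W(A, u)`, `dim Bᵏ ⊗ ℂ = C(2k, k) + 2`

Topic `Literature/AlgebraicGeometry/ComplexMultiplication` (family `hodge`, lane `lit-hodgefound`; the ALGEBRAIC carrier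
`Motives.AbelianVariety ℂ`), sequel of `EndomorphismFieldWeilTypePairsExist` (dimension `4`: Mumford's pair).  Here:
every even dimension, by DODSON's degenerate types of rank `n − l + 2` with `l = 2` (rank `n = dim A`: Kubota corank
EXACTLY one) read through the corank-one dichotomy of `EndomorphismFieldCorankOneWeilPlane`.

PRINTED STATEMENTS.  B. Dodson, *The structure of Galois groups of CM-fields*, Trans. AMS 283 (1984), **§3.2.1
Theorem** (as rendered by the tree's `Pohlmann1968.exists_simple_degenerate_of_eq_mul`): for `n = kl`, `k ≥ 3`,
`l ≥ 2` there exist simple abelian varieties of CM type of dimension `n`, degenerate of rank `dim MT = n − l + 2`;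
B. B. Gordon, *A survey of the Hodge conjecture for abelian varieties* (1999), **9.4.3** «Dodson: CM types of rank
`n − l + 2`» and 9.4; B. van Geemen, LNM 1594 (1994), 4.7, **4.9** (abelian varieties of Weil type `(X, K)` of
dimension `2n`), **Thm. 6.12** («`Bⁿ(X) = Dⁿ ⊕ ⋀_K^{2n} H¹(X, ℚ)`»); for `k = 2`: van Geemen Thm. 4.5 / Pohlmann §3
(Mumford's fourfold, previous file).

WHAT IS PROVED (theorems only; no definition, no named fact; NO hypothesis — the existence of CM abelian varieties is
the tree's theorem `PicardCM.CMAbelianVarietyRealised_holds`):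
* §1 **`exists_simple_pair_cmTypeRank_eq_dim`** (`k ≥ 3`): a SIMPLE pair `(A, ι : K → End_ℚ(A))`, `[K:ℚ] = 4k = 2 dim A`,
  `dim A = 2k`, whose type has Kubota rank EXACTLY `dim A` (corank one) — Dodson's `l = 2` type, realised, made a
  pair (`exists_pair_of_isCMTypeRealisation`), the rank read off `dim MT(H¹(A)) = Rank(Φ)`
  (`mtRank_hodge_one_eq_cmTypeRank`);
* §2 **`exists_simple_pair_isWeilType_of_three_le`** (`k ≥ 3`) and **`exists_simple_pair_isWeilType`** (EVERY
  `k ≥ 2`, the case `k = 2` being Mumford's pair): a simple pair of dimension `2k` and corank one with a WEIL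
  STRUCTURE `u ∈ End(A)`, `1 ⊗ u = ι(α)`, `IsWeilType A u k d` (corank one and simple ⟹ not stably nondegenerate
  ⟹ a Weil structure from `F`, `isStablyNondegenerate_or_exists_isWeilType`);
* §3 **`exists_simple_hodgeClassSpan_ne_divisorClassesSpan`** — IN EVERY EVEN DIMENSION `2k ≥ 4` THERE IS A SIMPLE
  abelian variety of CM type with `Bᵏ(A) ⊗ ℂ = Dᵏ(A) ⊗ ℂ ⊔ W(A, u) ⊗ ℂ ≠ Dᵏ(A) ⊗ ℂ`, `Dᵏ ⊓ W = 0`,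
  `dim_ℂ Bᵏ(A) ⊗ ℂ = C(2k, k) + 2`, and a rational `(k,k)`-class on `A` ITSELF outside `Dᵏ(A) ⊗ ℂ` (van Geemen 6.12's
  shape on a SIMPLE CM variety of every even dimension; Dodson's theorem gives an exceptional class only on some
  power and only for composite `n > 4`).

No `sorry`; axioms `propext`, `Classical.choice`, `Quot.sound`.

## References
* [Dodson1984] B. Dodson, *The structure of Galois groups of CM-fields*, Trans. AMS 283 (1984), §3.2.1 Theorem.
* [Gordon1999HodgeAVSurvey] B. B. Gordon, *A survey of the Hodge conjecture for abelian varieties* (1999), 9.1, 9.4,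
  9.4.3, Thm. 6.4, 5.13 (ii).
* [vanGeemen1994HodgeAV] B. van Geemen, LNM 1594 (1994), Thm. 4.5, 4.7, 4.9, Thm. 6.12.
* [Pohlmann1968] H. Pohlmann, Ann. of Math. 88 (1968), Thm. 1 and §3.
* [Shimura1998] G. Shimura, *Abelian Varieties with Complex Multiplication and Modular Functions* (1998), §6.2 Thm. 3.
-/

noncomputable section

open CategoryTheory NumberField Module

namespace Literature.AlgebraicGeometry.ComplexMultiplication

open scoped Classical
open Literature.AlgebraicGeometry.Motives Literature.AlgebraicGeometry.HodgeTheory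
open Literature.AlgebraicGeometry.Pohlmann1968 (IsNondegenerate cmTypeRank isNondegenerate_iff pohlmannSets
  pohlmannDivisorSets)
open Literature.AlgebraicGeometry.VanGeemen1994 (hodgeClassSpan)
open Literature.Barriers.HodgeConjecture (divisorClassesSpan)
open Literature.NumberTheory.ComplexMultiplication
open Literature.NumberTheory.Automorphic (PicardCM.CMAbelianVarietyRealised_holds)

namespace EndFieldFullDegree

/-! ### §1 Dodson's `l = 2` types: simple pairs of dimension `2k ≥ 6` and corank EXACTLY one -/

/-- **SIMPLE CM PAIRS OF CORANK EXACTLY ONE IN EVERY EVEN DIMENSION `2k ≥ 6`** (Dodson 1984 §3.2.1 with `l = 2`,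
`n = 2k`: rank `n − l + 2 = n = dim A`).  There are a CM field `K`, `[K:ℚ] = 4k`, and a SIMPLE pair
`(A, ι_K : K → End_ℚ(A))`, `[K:ℚ] = 2 dim A`, `dim A = 2k`, with a principal `ι : 𝓞_K → End A` under `ι_K`, whose
type `cmTypeOfPair ι_K` has Kubota rank `Rank = dim A` (the tree's `exists_simple_degenerate_of_eq_mul` at
`PicardCM.CMAbelianVarietyRealised_holds`, made a pair by `exists_pair_of_isCMTypeRealisation`; the rank via Gordon 9.1
`dim MT(H¹(A)) = Rank(Φ)`, `mtRank_hodge_one_eq_cmTypeRank`). [cite: Dodson1984, §3.2.1 Theorem]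
[cite: Gordon1999HodgeAVSurvey, 9.1 and 9.4.3] [cite: Shimura1998, §6.2 Thm. 3] -/
theorem exists_simple_pair_cmTypeRank_eq_dim {k : ℕ} (hk : 3 ≤ k) :
    ∃ (K : Type) (_ : Field K) (_ : NumberField K) (_ : IsCMField K) (A : AbelianVariety ℂ) (ι : 𝓞 K →+* End A)
      (ιK : K →+* A.endAlgebra) (hK : finrank ℚ K = 2 * A.dim),
      (∀ a : 𝓞 K, ιK a = AbelianVariety.endAlgebra.of A (ι a)) ∧ AbelianVariety.IsSimple A ∧ A.dim = 2 * k ∧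
        cmTypeRank (cmTypeOfPair ιK hK) = A.dim := by
  obtain ⟨K, _, _, _, Φ, A, ι, θ, hA, -, hS, hdim, hmt, -⟩ :=
    Pohlmann1968.exists_simple_degenerate_of_eq_mul PicardCM.CMAbelianVarietyRealised_holds hk (le_refl 2)
      (Nat.mul_comm k 2).symm
  obtain ⟨ιK, hK, -, hιK, hΦ⟩ := exists_pair_of_isCMTypeRealisation hA
  refine ⟨K, inferInstance, inferInstance, inferInstance, A, ι, ιK, hK, hιK, hS, hdim, ?_⟩
  haveI : HodgeTensorFacts.{0, 0} := Motives.hodgeTensorFacts_holds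
  haveI := BettiUniverse.finite hA.1 1
  have hr := mtRank_hodge_one_eq_cmTypeRank ιK hK hA.1
  have h2 : 2 * k - 2 + 2 = 2 * k := by omega
  rw [h2, ← hdim] at hmt
  rw [← hr]
  exact hmt

/-! ### §2 A Weil structure on a simple pair of corank one, every even dimension -/

/-- **SIMPLE PAIRS OF WEIL TYPE IN EVERY EVEN DIMENSION `2k ≥ 6`**: a simple pair `(A, ι_K)`, `dim A = 2k`, of
corank EXACTLY one carries a WEIL STRUCTURE `u ∈ End(A)`, `1 ⊗ u = ι_K(α)`, `IsWeilType A u k d` — a simple pair of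
corank `≤ 1` is stably nondegenerate or of Weil type (`isStablyNondegenerate_or_exists_isWeilType`), and rank
`dim A < dim A + 1` rules out nondegeneracy (`isStablyNondegenerate_iff_isNondegenerate_cmTypeOfPair_of_isSimple`).
[cite: Dodson1984, §3.2.1 Theorem] [cite: vanGeemen1994HodgeAV, 4.7 and 4.9] [cite: Gordon1999HodgeAVSurvey, 9.4.3 and Thm. 6.4] -/
theorem exists_simple_pair_isWeilType_of_three_le {k : ℕ} (hk : 3 ≤ k) :
    ∃ (K : Type) (_ : Field K) (_ : NumberField K) (_ : IsCMField K) (A : AbelianVariety ℂ)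
      (ιK : K →+* A.endAlgebra) (hK : finrank ℚ K = 2 * A.dim) (α : K) (u : End A) (d : ℕ),
      AbelianVariety.IsSimple A ∧ A.dim = 2 * k ∧ cmTypeRank (cmTypeOfPair ιK hK) = A.dim ∧
        AbelianVariety.endAlgebra.of A u = ιK α ∧ HodgeTheory.IsWeilType A u k d := by
  obtain ⟨K, _, _, _, A, ι, ιK, hK, -, hS, hdim, hrk⟩ := exists_simple_pair_cmTypeRank_eq_dim hk
  have hrank : A.dim ≤ cmTypeRank (cmTypeOfPair ιK hK) := hrk.ge
  have hnd : ¬ IsStablyNondegenerate A := by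
    rw [isStablyNondegenerate_iff_isNondegenerate_cmTypeOfPair_of_isSimple ιK hK hS, isNondegenerate_iff, hrk]
    omega
  rcases isStablyNondegenerate_or_exists_isWeilType ιK hK hS hrank with h | ⟨α, u, n, d, hu, hW⟩
  · exact absurd h hnd
  · have hn : n = k := by have := hW.dim_eq; omega
    subst hn
    exact ⟨K, inferInstance, inferInstance, inferInstance, A, ιK, hK, α, u, d, hS, hdim, hrk, hu, hW⟩

/-- **SIMPLE PAIRS OF WEIL TYPE AND CORANK ONE EXIST IN EVERY EVEN DIMENSION `2k ≥ 4`** — `k = 2`: Mumford's pair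
(`MumfordPair.exists_simple_fourfold_pair_isWeilType`, van Geemen Thm. 4.5 / Pohlmann §3); `k ≥ 3`: Dodson's
`l = 2` types (`exists_simple_pair_isWeilType_of_three_le`). [cite: vanGeemen1994HodgeAV, Thm. 4.5, 4.7 and 4.9]
[cite: Dodson1984, §3.2.1 Theorem] [cite: Pohlmann1968, §3] [cite: Gordon1999HodgeAVSurvey, 8.2 and 9.4.3] -/
theorem exists_simple_pair_isWeilType {k : ℕ} (hk : 2 ≤ k) :
    ∃ (K : Type) (_ : Field K) (_ : NumberField K) (_ : IsCMField K) (A : AbelianVariety ℂ)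
      (ιK : K →+* A.endAlgebra) (hK : finrank ℚ K = 2 * A.dim) (α : K) (u : End A) (d : ℕ),
      AbelianVariety.IsSimple A ∧ A.dim = 2 * k ∧ cmTypeRank (cmTypeOfPair ιK hK) = A.dim ∧
        AbelianVariety.endAlgebra.of A u = ιK α ∧ HodgeTheory.IsWeilType A u k d := by
  rcases Nat.lt_or_ge k 3 with h3 | h3
  · obtain rfl : k = 2 := by omega
    obtain ⟨P, -, hP⟩ := Finset.exists_subset_card_eq
      (s := (Finset.univ : Finset (Literature.NumberTheory.NumberFields.MumfordQuartic.F →+* ℂ))) (n := 2)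
      (by rw [Finset.card_univ, Literature.NumberTheory.NumberFields.MumfordQuartic.card_embeddings]; norm_num)
    obtain ⟨A, ρ, ιK, hK, w, -, -, hΦ, hS, h4, hu, hW⟩ := MumfordPair.exists_simple_fourfold_pair_isWeilType hP
    refine ⟨_, inferInstance, inferInstance, inferInstance, A, ιK, hK, _, _, 1, hS, h4, ?_, hu, hW⟩
    rw [hΦ, MumfordPair.cmTypeRank_weilType hP, h4]
  · exact exists_simple_pair_isWeilType_of_three_le h3

/-! ### §3 `Bᵏ(A) ⊗ ℂ = Dᵏ(A) ⊗ ℂ ⊕ W ≠ Dᵏ(A) ⊗ ℂ` on a SIMPLE CM abelian `2k`-fold, every `k ≥ 2` -/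

/-- **IN EVERY EVEN DIMENSION `2k ≥ 4` THERE IS A SIMPLE ABELIAN VARIETY OF CM TYPE WITH `Bᵏ(A) ≠ Dᵏ(A)`**, and more
precisely with van Geemen's decomposition for a Weil structure `u` of type `(k, d)`:
`Bᵏ(A) ⊗ ℂ = Dᵏ(A) ⊗ ℂ ⊔ W(A, u) ⊗ ℂ`, `Dᵏ ⊗ ℂ ⊓ W ⊗ ℂ = 0`, `dim_ℂ Bᵏ(A) ⊗ ℂ = C(2k, k) + 2`, and a rational
`(k,k)`-class ON `A` ITSELF outside `Dᵏ(A) ⊗ ℂ` («`Bⁿ(X) = Dⁿ ⊕ ⋀_K^{2n} H¹(X, ℚ)`» on a SIMPLE CM variety — Mumford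
for `k = 2`, Dodson's `l = 2` types for `k ≥ 3`; the corank-one file's `hodgeClassSpan_eq_divisorClassesSpan_sup_weilClassesOf`,
`finrank_hodgeClassSpan_mid_eq_choose_add_two`, `exists_isWeilType_iff_exists_exceptional`, now NON-VACUOUS in every
even dimension). [cite: vanGeemen1994HodgeAV, Thm. 6.12, 4.9 and Thm. 4.5] [cite: Dodson1984, §3.2.1 Theorem]
[cite: Gordon1999HodgeAVSurvey, 9.4.3 and 5.13 (ii)] [cite: Milne1999, §2 p. 54] -/
theorem exists_simple_hodgeClassSpan_ne_divisorClassesSpan {k : ℕ} (hk : 2 ≤ k) :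
    ∃ (A : AbelianVariety ℂ) (u : End A) (d : ℕ), AbelianVariety.IsSimple A ∧ A.dim = 2 * k ∧
      Milne1999.IsOfCMType A ∧ HodgeTheory.IsWeilType A u k d ∧
      hodgeClassSpan A.dim A.X k = divisorClassesSpan A.X A.dim k ⊔ weilClassesOf A u k d ∧
      divisorClassesSpan A.X A.dim k ⊓ weilClassesOf A u k d = ⊥ ∧
      Module.finrank ℂ ↥(hodgeClassSpan A.dim A.X k) = (2 * k).choose k + 2 ∧
      hodgeClassSpan A.dim A.X k ≠ divisorClassesSpan A.X A.dim k ∧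
      ∃ c : complexBetti A.X (2 * k), IsRationalClass c ∧ IsOfHodgeType A.dim A.X (2 * k) k k c ∧
        c ∉ divisorClassesSpan A.X A.dim k := by
  obtain ⟨K, _, _, _, A, ιK, hK, α, u, d, hS, hdim, hrk, hu, hW⟩ := exists_simple_pair_isWeilType hk
  have hrank : A.dim ≤ cmTypeRank (cmTypeOfPair ιK hK) := hrk.ge
  -- an exceptional class on `A` itself, in the middle degree
  obtain ⟨p, c, hcQ, hcH, hcD⟩ := (exists_isWeilType_iff_exists_exceptional ιK hK hS hrank).1 ⟨α, u, k, d, hu, hW⟩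
  have hp : p = k := by
    have h := two_mul_eq_dim_of_not_mem_divisorClassesSpan ιK hK hS hrank hcQ hcH hcD
    omega
  subst hp
  refine ⟨A, u, d, hS, hdim, isOfCMType ιK hK, hW,
    hodgeClassSpan_eq_divisorClassesSpan_sup_weilClassesOf ιK hK hS hrank hu hW,
    divisorClassesSpan_inf_weilClassesOf_eq_bot' ιK hK hS hrank hu hW,
    finrank_hodgeClassSpan_mid_eq_choose_add_two ιK hK hS hrank hu hW, fun hBD => ?_, c, hcQ, hcH, hcD⟩
  exact hcD (hBD ▸ Submodule.subset_span ⟨hcQ, hcH⟩)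

end EndFieldFullDegree

end Literature.AlgebraicGeometry.ComplexMultiplication

end
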